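/-
Copyright (c) 2026. Released under Apache 2.0 license.
-/
import Literature.RepresentationTheory.KonnoKonno2007.RealUnitaryDualPairBallFrame
import Literature.RepresentationTheory.KonnoKonno2007.JunctionDegreeOneKTypes
import Literature.AlgebraicGeometry.ShimuraVarieties.UnitaryBallCotangentWeight
import HarnessLib

/-!
# The `(1,0)`-harmonic `K_∞`-type of the cell junction in the ball frame

For the cell's dual pair `U(2,1) × U(1)`, realised as
`Ginf (Fin 2) Unit Unit Empty = UForm (Fin 2) Unit × UForm Unit Empty`, and a junction `ω` (a phase-covariant,
unitarily-liftable representation of `Ginf` on `𝓢(ℝ^{DPIdx})` with vacuum values `vacScalar e`), this file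
records, in the BALL FRAME `u21FrameEquiv : U21 ≃ₜ* UForm (Fin 2) Unit` of `RealUnitaryDualPairBallFrame`, the
`Stab(x₀)`-equivariance of the holomorphic degree-one family `degOneP`:

* `apply_frame_stabilizer_degOneP` — for `u ∈ Stab_{U21}(x₀)` with `stabilizerEquivK21⁻¹ u = (A, d)`,
  `ω ((u21FrameEquiv u, 1)) (degOneP b) = (det A ^ e_P * d ^ e_Q) • degOneP (A *ᵥ b)`
  (Folland's `K`-type computation, transported along the frame);
* `apply_frame_stabilizer_degOneP_of_exponents` — at the exponents `e_P = 0`, `e_Q = -1` this is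
  `degOneP (pPlus (stabilizerEquivK21⁻¹ u) b)`, i.e. the family is equivariant of type `pPlus : (A,d) ↦ d̄ • A`;
* `apply_frame_stabilizer_degOneP_eq_weightOf_dual` — the same right-hand side written through the dual of the
  weight `weightOf x₀` of the cotangent cocycle of the ball (`weightOf_cotangent_dual_apply` of
  `UnitaryBallCotangentWeight`):
  `ω ((u21FrameEquiv u, 1)) (degOneP b) = degOneP (⟨·,·⟩⁻¹ ((weightOf x₀)^∨ u ⟨b,·⟩))`,
  the harmonic-representative identity `ω_∞(κ₁ u) ∘ Φ = Φ ∘ τ₁^∨(u)` for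
  `Φ := degOneP ∘ ⟨·,·⟩⁻¹`, `τ₁ := weightOf x₀`, at these exponents;
* `apply_frame_stabilizer_degOneP_dual` — the same over linear functionals `ℓ : (ℂ²)^*` (the consumer's literal
  shape `ω_∞ (κ₁ u) (Φ ℓ) = Φ (τ₁^∨ u ℓ)` before carrier transport).

All statements are kernel-proved from the cited tree files; no records, no new definitions.

References: G. B. Folland, *Harmonic analysis in phase space* (1989), Prop. (4.39) (the `U(n)`-types of the Fock
model); M. Kashiwara, M. Vergne, Invent. Math. 44 (1978) §§ 2–3 (harmonic `K`-types for `U(p,q) × U(W)`);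
K. Konno, T. Konno, *On doubling construction for real unitary dual pairs*, Kyushu J. Math. 61 (2007) §3.1.
-/

noncomputable section

open MeasureTheory
open scoped Matrix MatrixGroups

namespace Literature.RepresentationTheory.KonnoKonno2007

namespace RealDualPair

open Literature.Analysis.SegalBargmann Literature.RepresentationTheory.HeisenbergGroup
open Literature.NumberTheory.Weil1964 Literature.NumberTheory.Automorphic
open Literature.NumberTheory.Automorphic.UnitaryGroup
open Literature.Geometry.ComplexHyperbolic.BallModel (U21 x₀ stabilizerEquivK21)
open Literature.NumberTheory.Automorphic.U21 (K21 matA sclD pPlus pPlus_apply star_sclD_mul_self)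
open Literature.AlgebraicGeometry.ShimuraVarieties.BallForms (weightOf_cotangent_dual_apply
  isPullbackCocycle_cotangentCocycle)

local notation "SR" σ => SchwartzMap (σ → ℝ) ℂ
local notation "PV" σ => (σ → ℝ) × (σ → ℝ)

/-- Notation (NOT a definition): `HasUnitaryLift[σ] A` abbreviates the (w2′) clause shape of
`IsArchWeilDatum.exists_lift` (as in `JunctionDegreeOneKTypes`). -/
local notation "HasUnitaryLift[" σ "]" A:max =>
  ∃ U : Lp ℂ 2 (volume : Measure (σ → ℝ)) ≃ₗᵢ[ℂ] Lp ℂ 2 (volume : Measure (σ → ℝ)),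
    LiftsTo A ((LinearIsometryEquiv.toContinuousLinearEquiv U :
        Lp ℂ 2 (volume : Measure (σ → ℝ)) ≃L[ℂ] Lp ℂ 2 (volume : Measure (σ → ℝ))) :
      Lp ℂ 2 (volume : Measure (σ → ℝ)) →L[ℂ] Lp ℂ 2 (volume : Measure (σ → ℝ)))

/-- `d ^ (-1) = d̄` for the `U(1)`-coordinate `sclD k` of `k ∈ K21`. [folklore] -/
theorem sclD_zpow_neg_one (k : K21) : sclD k ^ (-1 : ℤ) = star (sclD k) := by
  rw [zpow_neg_one]
  exact inv_eq_of_mul_eq_one_left (star_sclD_mul_self k)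

/-- The frame image of a stabiliser element, paired with `1 ∈ U(W)`, is the compact-pair element
`κ ((A, (d)), 1)` of `Ginf (Fin 2) Unit Unit Empty`. [cite: KonnoKonno2007, §3.1] -/
theorem frame_stabilizer_eq_κ (u : MulAction.stabilizer U21 x₀) :
    ((u21FrameEquiv (u : U21), (1 : UForm Unit Empty)) : Ginf (Fin 2) Unit Unit Empty) =
      κ (Fin 2) Unit Unit Empty
        (((stabilizerEquivK21.symm u).1, unitaryToUnit (stabilizerEquivK21.symm u).2), 1) := by
  rw [u21FrameEquiv_stabilizer, ← map_one (UForm.kV Unit Empty)]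
  rfl

variable (ω : Representation ℂ (Ginf (Fin 2) Unit Unit Empty) (SR (DPIdx (Fin 2) Unit Unit Empty)))

/-- **Folland's degree-one `K`-type in the ball frame.** For a junction `ω` of the cell pair with vacuum
exponents `e` and `u ∈ Stab_{U21}(x₀)` with `stabilizerEquivK21⁻¹ u = (A, d)`:
`ω ((u21FrameEquiv u, 1)) (degOneP b) = (det A ^ e_P * d ^ e_Q) • degOneP (A *ᵥ b)`.
[cite: Folland1989, Prop (4.39)] -/
theorem apply_frame_stabilizer_degOneP
    (hcov : IsPhaseCovariantS
      (fun g => ⇑((ι𝕎 (Fin 2) Unit Unit Empty g).1 :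
        (PV (DPIdx (Fin 2) Unit Unit Empty)) ≃ₗ[ℝ] PV (DPIdx (Fin 2) Unit Unit Empty))) (fun g => ω g))
    (hlift : ∀ g, HasUnitaryLift[DPIdx (Fin 2) Unit Unit Empty] (ω g)) {e : VacExponents}
    (hvac : ∀ k : DPK (Fin 2) Unit Unit Empty,
      ω (κ (Fin 2) Unit Unit Empty k) (hermitePi 0) = vacScalar e k • hermitePi 0)
    (u : MulAction.stabilizer U21 x₀) (b : Fin 2 → ℂ) :
    ω ((u21FrameEquiv (u : U21), (1 : UForm Unit Empty)) : Ginf (Fin 2) Unit Unit Empty) (degOneP b) =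
      ((matA (stabilizerEquivK21.symm u)).det ^ e.eP * sclD (stabilizerEquivK21.symm u) ^ e.eQ) •
        degOneP (matA (stabilizerEquivK21.symm u) *ᵥ b) := by
  rw [frame_stabilizer_eq_κ, apply_κ_degOneP_fst_ι₁ ω hcov hlift hvac, det_unitaryToUnit]

/-- **At the exponents `e_P = 0`, `e_Q = -1` the degree-one family is `Stab(x₀)`-equivariant of type
`pPlus`**: `ω ((u21FrameEquiv u, 1)) (degOneP b) = degOneP (pPlus (stabilizerEquivK21⁻¹ u) b)`
(`pPlus (A,d) b = d̄ • A b`).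
[cite: KashiwaraVergne1978, §2–§3] -/
theorem apply_frame_stabilizer_degOneP_of_exponents
    (hcov : IsPhaseCovariantS
      (fun g => ⇑((ι𝕎 (Fin 2) Unit Unit Empty g).1 :
        (PV (DPIdx (Fin 2) Unit Unit Empty)) ≃ₗ[ℝ] PV (DPIdx (Fin 2) Unit Unit Empty))) (fun g => ω g))
    (hlift : ∀ g, HasUnitaryLift[DPIdx (Fin 2) Unit Unit Empty] (ω g)) {e : VacExponents}
    (he : e.eP = 0) (heQ : e.eQ = -1)
    (hvac : ∀ k : DPK (Fin 2) Unit Unit Empty,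
      ω (κ (Fin 2) Unit Unit Empty k) (hermitePi 0) = vacScalar e k • hermitePi 0)
    (u : MulAction.stabilizer U21 x₀) (b : Fin 2 → ℂ) :
    ω ((u21FrameEquiv (u : U21), (1 : UForm Unit Empty)) : Ginf (Fin 2) Unit Unit Empty) (degOneP b) =
      degOneP (pPlus (stabilizerEquivK21.symm u) b) := by
  rw [apply_frame_stabilizer_degOneP ω hcov hlift hvac, he, heQ, pPlus_apply, map_smul, zpow_zero, one_mul,
    sclD_zpow_neg_one]

/-- **The harmonic-representative identity `ω_∞(κ₁ u) ∘ Φ = Φ ∘ τ₁^∨(u)`** for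
`Φ := degOneP ∘ ⟨·,·⟩⁻¹` and
`τ₁ := weightOf x₀` of the cotangent cocycle of the ball, at the exponents `e_P = 0`, `e_Q = -1`:
`ω ((u21FrameEquiv u, 1)) (degOneP b) = degOneP (⟨·,·⟩⁻¹ ((weightOf x₀)^∨ u ⟨b,·⟩))`.
[cite: KashiwaraVergne1978, §2–§3] -/
theorem apply_frame_stabilizer_degOneP_eq_weightOf_dual
    (hcov : IsPhaseCovariantS
      (fun g => ⇑((ι𝕎 (Fin 2) Unit Unit Empty g).1 :
        (PV (DPIdx (Fin 2) Unit Unit Empty)) ≃ₗ[ℝ] PV (DPIdx (Fin 2) Unit Unit Empty))) (fun g => ω g))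
    (hlift : ∀ g, HasUnitaryLift[DPIdx (Fin 2) Unit Unit Empty] (ω g)) {e : VacExponents}
    (he : e.eP = 0) (heQ : e.eQ = -1)
    (hvac : ∀ k : DPK (Fin 2) Unit Unit Empty,
      ω (κ (Fin 2) Unit Unit Empty k) (hermitePi 0) = vacScalar e k • hermitePi 0)
    (u : MulAction.stabilizer U21 x₀) (b : Fin 2 → ℂ) :
    ω ((u21FrameEquiv (u : U21), (1 : UForm Unit Empty)) : Ginf (Fin 2) Unit Unit Empty) (degOneP b) =
      degOneP ((dotProductEquiv ℂ (Fin 2)).symm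
        ((isPullbackCocycle_cotangentCocycle.weightOf x₀).dual u (dotProductEquiv ℂ (Fin 2) b))) := by
  rw [apply_frame_stabilizer_degOneP_of_exponents ω hcov hlift he heQ hvac, weightOf_cotangent_dual_apply,
    LinearEquiv.symm_apply_apply]

/-- **`harm` in the consumer's shape** (linear functionals `ℓ` on `ℂ²` instead of vectors): at the
exponents `e_P = 0`, `e_Q = -1`, for every `u ∈ Stab_{U21}(x₀)` and `ℓ : (ℂ²)^*`,
`ω ((u21FrameEquiv u, 1)) (degOneP (⟨·,·⟩⁻¹ ℓ)) = degOneP (⟨·,·⟩⁻¹ ((weightOf x₀)^∨ u ℓ))`;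
so for ANY carrier transport `T`, `ω_∞ g := T ∘ ω (u21FrameEquiv g, 1) ∘ T⁻¹` and
`Φ := T ∘ degOneP ∘ ⟨·,·⟩⁻¹` satisfy `ω_∞ (κ₁ u) (Φ ℓ) = Φ (τ₁^∨ u ℓ)` with `τ₁ := weightOf x₀`.
[cite: KashiwaraVergne1978, §2–§3] -/
theorem apply_frame_stabilizer_degOneP_dual
    (hcov : IsPhaseCovariantS
      (fun g => ⇑((ι𝕎 (Fin 2) Unit Unit Empty g).1 :
        (PV (DPIdx (Fin 2) Unit Unit Empty)) ≃ₗ[ℝ] PV (DPIdx (Fin 2) Unit Unit Empty))) (fun g => ω g))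
    (hlift : ∀ g, HasUnitaryLift[DPIdx (Fin 2) Unit Unit Empty] (ω g)) {e : VacExponents}
    (he : e.eP = 0) (heQ : e.eQ = -1)
    (hvac : ∀ k : DPK (Fin 2) Unit Unit Empty,
      ω (κ (Fin 2) Unit Unit Empty k) (hermitePi 0) = vacScalar e k • hermitePi 0)
    (u : MulAction.stabilizer U21 x₀) (ℓ : Module.Dual ℂ (Fin 2 → ℂ)) :
    ω ((u21FrameEquiv (u : U21), (1 : UForm Unit Empty)) : Ginf (Fin 2) Unit Unit Empty)
        (degOneP ((dotProductEquiv ℂ (Fin 2)).symm ℓ)) =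
      degOneP ((dotProductEquiv ℂ (Fin 2)).symm
        ((isPullbackCocycle_cotangentCocycle.weightOf x₀).dual u ℓ)) := by
  rw [apply_frame_stabilizer_degOneP_eq_weightOf_dual ω hcov hlift he heQ hvac, LinearEquiv.apply_symm_apply]

end RealDualPair

end Literature.RepresentationTheory.KonnoKonno2007
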